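import Literature.Geometry.Lorentzian.KerrCylinderSpinExpansionK
import HarnessLib

/-!
# Second-order expansion of the Kerr cylinder data in the parameters `(m, a)`

Support file (all results proved; no named facts) for the named fact `LiMei.interiorKerrGluing`
(`InteriorKerrGluing.lean`; J. Li, H. Mei, *A construction of collapsing spacetimes in vacuum*,
Comm. Math. Phys. 378 (2020) = arXiv:2005.01249, Prop. 4.1). Li–Mei (4.2) reads
`ḡ_{m,a} = ḡ_m − 4ma r₀⁻¹ sin²θ dt dφ + O(a²)`, `k̄_{m,a} = k̄_m − 2ma r₀⁻² sin²θ (2m/r₀−1)^{1/2} dt dφ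
+ O(a²)`; the first-order terms are `hasDerivAt_cylH₀_spin` / `hasDerivAt_cylK₀_spin`
(`KerrCylinderSpinExpansion(K).lean`). This file supplies the **`O(a²)`, uniformly**: the
second-order Taylor expansion of the (closed-form) Kerr cylinder data in the two parameters
`(m, a)` at `(M, 0)`, with a remainder `≤ C (|m − M| + |a|)²` uniform on the shell
`ρ₁ < ‖y‖ < ρ₂` (`ρ₁ ≥ 1`) and on unit vectors:

* `exists_norm_taylor₂_le_parametric` — the generic statement: for `Φ : P × E → G` of class `C²`
  near `K × L` (`K` convex compact, `L` compact),
  `‖Φ(p, y) − Φ(p₀, y) − D₁Φ(p₀, y)(p − p₀)‖ ≤ C ‖p − p₀‖²` (mean value inequality applied to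
  `q ↦ Φ(q, y) − D₁Φ(p₀, y) q`, whose derivative is Lipschitz in `q` uniformly in `y` by
  `exists_norm_sub_le_mul_norm_sub_of_contDiffOn`);
* `LiMei.exists_abs_cylH₀_taylor₂_le` — **the metric**:
  `|H₀[m, a](y)(v, w) − ḡ_M(y)(v, w) − (m − M)·(2/r₀) dt²(v, w) − a·(first-order spin term)|
  ≤ C (|m − M| + |a|)²`;
* `LiMei.exists_abs_cylK₀_taylor₂_le` — **the second fundamental form**, with the `m`-derivative of
  `k̄_m` (`LiMei.hasDerivAt_kbarRep_mass`) and the first-order spin term of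
  `hasDerivAt_cylK₀_spin`.

## References

* J. Li, H. Mei, arXiv:2005.01249, §4, (4.2) (key `LiMei2020`).
-/

noncomputable section

open Set Filter Function Metric
open scoped ContDiff Topology RealInnerProductSpace

namespace Literature.Geometry.Lorentzian

attribute [local instance] instNormedAddCommGroupBilinE3 instNormedSpaceBilinE3

/-! ### Generic: a uniform second-order Taylor remainder in a parameter -/

section Taylor

variable {P E G : Type*} [NormedAddCommGroup P] [NormedSpace ℝ P] [NormedAddCommGroup E]
  [NormedSpace ℝ E] [NormedAddCommGroup G] [NormedSpace ℝ G]

/-- **Uniform second-order Taylor remainder in a parameter.** For `Φ : P × E → G` of class `C²` on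
an open set containing `K × L` (`K` convex compact, `L` compact) there is `C ≥ 0` with
`‖Φ(p, y) − Φ(p₀, y) − D₁Φ(p₀, y)(p − p₀)‖ ≤ C ‖p − p₀‖²` for all `p, p₀ ∈ K`, `y ∈ L`. [folklore] -/
theorem exists_norm_taylor₂_le_parametric {Φ : P × E → G} {U : Set (P × E)} (hU : IsOpen U)
    (hΦ : ContDiffOn ℝ 2 Φ U) {K : Set P} (hK : IsCompact K) (hKc : Convex ℝ K) {L : Set E}
    (hL : IsCompact L) (hKL : K ×ˢ L ⊆ U) :
    ∃ C : ℝ, 0 ≤ C ∧ ∀ p₀ ∈ K, ∀ p ∈ K, ∀ y ∈ L,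
      ‖Φ (p, y) - Φ (p₀, y) - fderiv ℝ (fun q ↦ Φ (q, y)) p₀ (p - p₀)‖ ≤ C * ‖p - p₀‖ ^ 2 := by
  -- the partial derivative `Ψ(q, y) = D₁Φ(q, y)` is `C¹` on `U`
  set Ψ : P × E → (P →L[ℝ] G) := fun q ↦ (fderiv ℝ Φ q).comp (ContinuousLinearMap.inl ℝ P E)
    with hΨ_def
  have hΨ : ContDiffOn ℝ 1 Ψ U :=
    (hΦ.fderiv_of_isOpen hU (by norm_num)).clm_comp contDiffOn_const
  obtain ⟨C₁, hC₁0, hC₁⟩ :=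
    Literature.Analysis.Calculus.exists_norm_sub_le_mul_norm_sub_of_contDiffOn hU hΨ hK hKc hL hKL
  refine ⟨C₁, hC₁0, fun p₀ hp₀ p hp y hy ↦ ?_⟩
  -- partial derivatives as `Ψ`
  have hpart : ∀ q ∈ K, HasFDerivAt (fun q : P ↦ Φ (q, y)) (Ψ (q, y)) q := by
    intro q hq
    have hqy : (q, y) ∈ U := hKL (mk_mem_prod hq hy)
    have hd : DifferentiableAt ℝ Φ (q, y) :=
      (hΦ.differentiableOn (by norm_num)).differentiableAt (hU.mem_nhds hqy)
    exact hd.hasFDerivAt.comp q (hasFDerivAt_prodMk_left q y)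
  have hfd : fderiv ℝ (fun q : P ↦ Φ (q, y)) p₀ = Ψ (p₀, y) := (hpart p₀ hp₀).fderiv
  -- mean value inequality for `g q = Φ(q, y) − Ψ(p₀, y) q` on the segment `[p₀, p] ⊆ K`
  have hseg : segment ℝ p₀ p ⊆ K := hKc.segment_subset hp₀ hp
  have hsegB : segment ℝ p₀ p ⊆ closedBall p₀ ‖p - p₀‖ :=
    (convex_closedBall p₀ ‖p - p₀‖).segment_subset (mem_closedBall_self (norm_nonneg _))
      (by rw [mem_closedBall, dist_eq_norm])
  have hg : ∀ q ∈ segment ℝ p₀ p, HasFDerivWithinAt (fun q : P ↦ Φ (q, y) - Ψ (p₀, y) q)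
      (Ψ (q, y) - Ψ (p₀, y)) (segment ℝ p₀ p) q := fun q hq ↦
    ((hpart q (hseg hq)).sub (Ψ (p₀, y)).hasFDerivAt).hasFDerivWithinAt
  have hbound : ∀ q ∈ segment ℝ p₀ p, ‖Ψ (q, y) - Ψ (p₀, y)‖ ≤ C₁ * ‖p - p₀‖ := by
    intro q hq
    have h1 := hC₁ p₀ hp₀ q (hseg hq) y hy
    have h2 : ‖q - p₀‖ ≤ ‖p - p₀‖ := by
      have h := hsegB hq
      rwa [mem_closedBall, dist_eq_norm] at h
    calc ‖Ψ (q, y) - Ψ (p₀, y)‖ ≤ C₁ * ‖q - p₀‖ := h1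
      _ ≤ C₁ * ‖p - p₀‖ := mul_le_mul_of_nonneg_left h2 hC₁0
  have hmv := (convex_segment p₀ p).norm_image_sub_le_of_norm_hasFDerivWithin_le hg hbound
    (left_mem_segment ℝ p₀ p) (right_mem_segment ℝ p₀ p)
  have e : Φ (p, y) - Ψ (p₀, y) p - (Φ (p₀, y) - Ψ (p₀, y) p₀) =
      Φ (p, y) - Φ (p₀, y) - Ψ (p₀, y) (p - p₀) := by
    rw [map_sub]; abel
  rw [e] at hmv
  rw [hfd]
  calc ‖Φ (p, y) - Φ (p₀, y) - Ψ (p₀, y) (p - p₀)‖ ≤ C₁ * ‖p - p₀‖ * ‖p - p₀‖ := hmv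
    _ = C₁ * ‖p - p₀‖ ^ 2 := by ring

omit [NormedAddCommGroup E] [NormedSpace ℝ E] in
/-- In the generic Taylor estimate, a partial derivative in a product parameter space `ℝ × ℝ`
splits into the two one-variable derivatives. [folklore] -/
theorem fderiv_curry_apply_of_hasDerivAt {E : Type*} {Φ : (ℝ × ℝ) × E → G} {p₀ : ℝ × ℝ} {y : E}
    (hΦ : DifferentiableAt ℝ (fun q : ℝ × ℝ ↦ Φ (q, y)) p₀) {D₁ D₂ : G}
    (h₁ : HasDerivAt (fun s : ℝ ↦ Φ ((s, p₀.2), y)) D₁ p₀.1)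
    (h₂ : HasDerivAt (fun s : ℝ ↦ Φ ((p₀.1, s), y)) D₂ p₀.2) (δ : ℝ × ℝ) :
    fderiv ℝ (fun q : ℝ × ℝ ↦ Φ (q, y)) p₀ δ = δ.1 • D₁ + δ.2 • D₂ := by
  have hF := hΦ.hasFDerivAt
  -- the two coordinate curves through `p₀`
  have c₁ : HasDerivAt (fun s : ℝ ↦ ((s, p₀.2) : ℝ × ℝ)) ((1 : ℝ), (0 : ℝ)) p₀.1 :=
    (hasDerivAt_id' p₀.1).prodMk (hasDerivAt_const _ _)
  have c₂ : HasDerivAt (fun s : ℝ ↦ ((p₀.1, s) : ℝ × ℝ)) ((0 : ℝ), (1 : ℝ)) p₀.2 :=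
    (hasDerivAt_const _ _).prodMk (hasDerivAt_id' p₀.2)
  have e₁ : fderiv ℝ (fun q : ℝ × ℝ ↦ Φ (q, y)) p₀ ((1 : ℝ), (0 : ℝ)) = D₁ := by
    have hF₁ : HasFDerivAt (fun q : ℝ × ℝ ↦ Φ (q, y)) (fderiv ℝ (fun q : ℝ × ℝ ↦ Φ (q, y)) p₀)
        ((fun s : ℝ ↦ ((s, p₀.2) : ℝ × ℝ)) p₀.1) := by simpa using hF
    have hc := hF₁.comp_hasDerivAt p₀.1 c₁
    exact hc.unique h₁
  have e₂ : fderiv ℝ (fun q : ℝ × ℝ ↦ Φ (q, y)) p₀ ((0 : ℝ), (1 : ℝ)) = D₂ := by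
    have hF₂ : HasFDerivAt (fun q : ℝ × ℝ ↦ Φ (q, y)) (fderiv ℝ (fun q : ℝ × ℝ ↦ Φ (q, y)) p₀)
        ((fun s : ℝ ↦ ((p₀.1, s) : ℝ × ℝ)) p₀.2) := by simpa using hF
    have hc := hF₂.comp_hasDerivAt p₀.2 c₂
    exact hc.unique h₂
  have hδ : δ = δ.1 • ((1 : ℝ), (0 : ℝ)) + δ.2 • ((0 : ℝ), (1 : ℝ)) := by
    ext <;> simp
  conv_lhs => rw [hδ]
  rw [map_add, map_smul, map_smul, e₁, e₂]

end Taylor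

namespace LiMei

/-! ### The metric of the Kerr cylinders -/

/-- The `m`-derivative of the Schwarzschild cylinder metric: `∂_m ḡ_m = (2/r₀) dt²`. [cite: LiMei2020, (4.1)] -/
theorem hasDerivAt_gbarRep_mass (M r₀ : ℝ) (y v w : E3) :
    HasDerivAt (fun m : ℝ ↦ gbarRep m r₀ y v w) (2 / r₀ * (⟪y, v⟫ * ⟪y, w⟫ / ‖y‖ ^ 2)) M := by
  have h := ((((hasDerivAt_id' M).const_mul 2).div_const r₀).sub_const 1).mul_const
    (⟪y, v⟫ * ⟪y, w⟫ / ‖y‖ ^ 2)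
  have h' := h.add_const (r₀ ^ 2 / ‖y‖ ^ 2 * (⟪v, w⟫ - ⟪y, v⟫ * ⟪y, w⟫ / ‖y‖ ^ 2))
  refine (h'.congr_of_eventuallyEq (Eventually.of_forall fun m ↦ rfl)).congr_deriv ?_
  ring

/-- **Second-order expansion of the Kerr cylinder metric in `(m, a)` at `(M, 0)`, uniformly on a
shell** (Li–Mei (4.2), first line, with its `O(a²)`): for `0 < r₀`, `1 ≤ ρ₁`, there are `δ > 0`,
`C ≥ 0` such that for `|m − M| + |a| ≤ δ`, every rotation `R`, unit vectors `v, w` and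
`ρ₁ < ‖y‖ < ρ₂`,
`|H[m,a,R](y)(v,w) − ḡ_M(y)(v,w) − (m − M)(2/r₀) dt²(v,w) − a·(2M/(r₀‖y‖³))((Ry)₁(Rv)₀ − (Ry)₀(Rv)₁)⟪y,w⟫
  + ⟪y,v⟫((Ry)₁(Rw)₀ − (Ry)₀(Rw)₁))| ≤ C (|m − M| + |a|)²`. [cite: LiMei2020, (4.2)] -/
theorem exists_abs_cylH_taylor₂_le (M : ℝ) {r₀ : ℝ} (hr₀ : 0 < r₀) {ρ₁ : ℝ} (hρ₁ : 1 ≤ ρ₁)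
    (ρ₂ τ₀ : ℝ) :
    ∃ C : ℝ, 0 ≤ C ∧ ∀ (m a : ℝ), |m - M| + |a| ≤ 1 → ∀ (R : E3 →ₗᵢ[ℝ] E3) (v w : E3),
      ‖v‖ ≤ 1 → ‖w‖ ≤ 1 → ∀ y : E3, ρ₁ < ‖y‖ → ‖y‖ < ρ₂ →
        |cylH m a r₀ τ₀ R y v w - gbarRep M r₀ y v w -
            (m - M) * (2 / r₀ * (⟪y, v⟫ * ⟪y, w⟫ / ‖y‖ ^ 2)) -
            a * (2 * M / (r₀ * ‖y‖ ^ 3) * ((R y 1 * R v 0 - R y 0 * R v 1) * ⟪y, w⟫ +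
              ⟪y, v⟫ * (R y 1 * R w 0 - R y 0 * R w 1)))| ≤
          C * (|m - M| + |a|) ^ 2 := by
  -- the smooth family and the compact sets
  set Φ : (ℝ × ℝ) × E3 → (E3 →L[ℝ] E3 →L[ℝ] ℝ) := fun q ↦
    cylH₀ q.1.1 q.1.2 r₀ τ₀ LinearIsometry.id q.2 with hΦ_def
  have hU : IsOpen {q : (ℝ × ℝ) × E3 | q.2 ≠ 0} := isOpen_ne.preimage continuous_snd
  have hΦs : ContDiffOn ℝ 2 Φ {q : (ℝ × ℝ) × E3 | q.2 ≠ 0} := by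
    intro q hq
    have hq' : q.2 ≠ 0 := hq
    have h := (contDiffOn_cylH₀₃ hr₀ τ₀ LinearIsometry.id).contDiffAt
      ((isOpen_ne.preimage (continuous_snd.comp continuous_snd)).mem_nhds
        (show (q.1.1, q.1.2, q.2).2.2 ≠ 0 from hq'))
    have h2 : ContDiffAt ℝ ∞ Φ q := h.comp q ((contDiffAt_fst.comp q contDiffAt_fst).prodMk
      ((contDiffAt_snd.comp q contDiffAt_fst).prodMk contDiffAt_snd))
    exact (h2.of_le (WithTop.coe_le_coe.mpr le_top)).contDiffWithinAt
  have hK : IsCompact (closedBall ((M, 0) : ℝ × ℝ) 1) := isCompact_closedBall _ _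
  have hKc : Convex ℝ (closedBall ((M, 0) : ℝ × ℝ) 1) := convex_closedBall _ _
  have hL : IsCompact {y : E3 | ρ₁ ≤ ‖y‖ ∧ ‖y‖ ≤ ρ₂} :=
    Metric.isCompact_of_isClosed_isBounded
      ((isClosed_le continuous_const continuous_norm).inter (isClosed_le continuous_norm continuous_const))
      (isBounded_closedBall.subset fun y hy ↦ mem_closedBall_zero_iff.2 hy.2)
  have hL0 : ∀ y ∈ {y : E3 | ρ₁ ≤ ‖y‖ ∧ ‖y‖ ≤ ρ₂}, y ≠ 0 := fun y hy h ↦ by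
    have h1 : ρ₁ ≤ ‖y‖ := hy.1
    rw [h, norm_zero] at h1
    linarith
  have hKL : closedBall ((M, 0) : ℝ × ℝ) 1 ×ˢ {y : E3 | ρ₁ ≤ ‖y‖ ∧ ‖y‖ ≤ ρ₂} ⊆
      {q : (ℝ × ℝ) × E3 | q.2 ≠ 0} := fun q hq ↦ hL0 q.2 hq.2
  obtain ⟨C, hC0, hC⟩ := exists_norm_taylor₂_le_parametric hU hΦs hK hKc hL hKL
  refine ⟨C, hC0, fun m a hma R v w hv hw y hy₁ hy₂ ↦ ?_⟩
  have hy0 : y ≠ 0 := fun h ↦ by rw [h, norm_zero] at hy₁; linarith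
  have hp₀ : ((M, 0) : ℝ × ℝ) ∈ closedBall ((M, 0) : ℝ × ℝ) 1 := mem_closedBall_self zero_le_one
  have hp : ((m, a) : ℝ × ℝ) ∈ closedBall ((M, 0) : ℝ × ℝ) 1 := by
    rw [mem_closedBall, dist_eq_norm, Prod.norm_def]
    refine max_le ?_ ?_
    · show ‖m - M‖ ≤ 1
      rw [Real.norm_eq_abs]; linarith [abs_nonneg a]
    · show ‖a - 0‖ ≤ 1
      rw [sub_zero, Real.norm_eq_abs]; linarith [abs_nonneg (m - M)]
  have hRy : R y ∈ {y : E3 | ρ₁ ≤ ‖y‖ ∧ ‖y‖ ≤ ρ₂} := by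
    refine ⟨?_, ?_⟩ <;> rw [LinearIsometry.norm_map] <;> linarith
  have hRy0 : R y ≠ 0 := isometry_apply_ne_zero R hy0
  have key := hC _ hp₀ _ hp _ hRy
  -- identification of the partial derivatives at `(M, 0)` on the vectors `Rv`, `Rw`
  have hdiff : DifferentiableAt ℝ (fun q : ℝ × ℝ ↦ Φ (q, R y)) (M, 0) := by
    have hq : (((M, 0) : ℝ × ℝ), R y) ∈ {q : (ℝ × ℝ) × E3 | q.2 ≠ 0} := hRy0
    have hd : DifferentiableAt ℝ Φ (((M, 0) : ℝ × ℝ), R y) :=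
      (hΦs.differentiableOn (by norm_num)).differentiableAt (hU.mem_nhds hq)
    have hf : DifferentiableAt ℝ (fun q : ℝ × ℝ ↦ ((q, R y) : (ℝ × ℝ) × E3)) (M, 0) :=
      differentiableAt_id.prodMk (differentiableAt_const _)
    have h := hd.comp (M, 0) hf
    exact h
  have hdiffvw : DifferentiableAt ℝ (fun q : ℝ × ℝ ↦ Φ (q, R y) (R v) (R w)) (M, 0) :=
    (evalBilin (R v) (R w)).differentiableAt.comp _ hdiff
  have h₁ : HasDerivAt (fun s : ℝ ↦ Φ ((s, ((M, 0) : ℝ × ℝ).2), R y) (R v) (R w))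
      (2 / r₀ * (⟪R y, R v⟫ * ⟪R y, R w⟫ / ‖R y‖ ^ 2)) ((M, 0) : ℝ × ℝ).1 := by
    have h := hasDerivAt_gbarRep_mass M r₀ (R y) (R v) (R w)
    refine h.congr_of_eventuallyEq (Eventually.of_forall fun s ↦ ?_)
    show Φ ((s, 0), R y) (R v) (R w) = gbarRep s r₀ (R y) (R v) (R w)
    exact cylH₀_zero_spin s hr₀ τ₀ LinearIsometry.id hRy0 (R v) (R w)
  have h₂ : HasDerivAt (fun s : ℝ ↦ Φ ((((M, 0) : ℝ × ℝ).1, s), R y) (R v) (R w))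
      (2 * M / (r₀ * ‖R y‖ ^ 3) * ((R y 1 * R v 0 - R y 0 * R v 1) * ⟪R y, R w⟫ +
        ⟪R y, R v⟫ * (R y 1 * R w 0 - R y 0 * R w 1))) ((M, 0) : ℝ × ℝ).2 :=
    hasDerivAt_cylH₀_spin M hr₀ τ₀ hRy0 (R v) (R w)
  have hsplit := fderiv_curry_apply_of_hasDerivAt
    (Φ := fun q : (ℝ × ℝ) × E3 ↦ (Φ q (R v) (R w))) hdiffvw h₁ h₂ ((m, a) - (M, 0))
  -- the form-valued derivative applied to `(Rv, Rw)` is the derivative of the applied function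
  have happly : fderiv ℝ (fun q : ℝ × ℝ ↦ Φ (q, R y)) (M, 0) ((m, a) - (M, 0)) (R v) (R w) =
      fderiv ℝ (fun q : ℝ × ℝ ↦ Φ (q, R y) (R v) (R w)) (M, 0) ((m, a) - (M, 0)) := by
    have h := ((evalBilin (R v) (R w)).hasFDerivAt.comp _ hdiff.hasFDerivAt).fderiv
    rw [show (fun q : ℝ × ℝ ↦ Φ (q, R y) (R v) (R w)) = (evalBilin (R v) (R w)) ∘
      (fun q : ℝ × ℝ ↦ Φ (q, R y)) from rfl, h]
    rfl
  -- the values at the two parameter points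
  have hval : Φ (((m, a) : ℝ × ℝ), R y) (R v) (R w) = cylH m a r₀ τ₀ R y v w := by
    show cylH₀ m a r₀ τ₀ LinearIsometry.id (R y) (R v) (R w) = cylH m a r₀ τ₀ R y v w
    rw [cylH_apply, cylCutoff_of_le_norm (hρ₁.trans hy₁.le), one_mul, sub_self, zero_mul, add_zero,
      cylH₀_isometry m a r₀ τ₀ R y v w]
  have hval₀ : Φ (((M, 0) : ℝ × ℝ), R y) (R v) (R w) = gbarRep M r₀ y v w := by
    show cylH₀ M 0 r₀ τ₀ LinearIsometry.id (R y) (R v) (R w) = gbarRep M r₀ y v w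
    rw [cylH₀_zero_spin M hr₀ τ₀ LinearIsometry.id hRy0, gbarRep_isometry]
  -- assemble: evaluate the form inequality on `(Rv, Rw)`
  have hev : |(Φ (((m, a) : ℝ × ℝ), R y) - Φ (((M, 0) : ℝ × ℝ), R y) -
      fderiv ℝ (fun q : ℝ × ℝ ↦ Φ (q, R y)) (M, 0) ((m, a) - (M, 0))) (R v) (R w)| ≤
      C * ‖((m, a) : ℝ × ℝ) - (M, 0)‖ ^ 2 := by
    have h1 := (evalBilin (R v) (R w)).le_opNorm (Φ (((m, a) : ℝ × ℝ), R y) -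
      Φ (((M, 0) : ℝ × ℝ), R y) - fderiv ℝ (fun q : ℝ × ℝ ↦ Φ (q, R y)) (M, 0) ((m, a) - (M, 0)))
    rw [evalBilin_apply, Real.norm_eq_abs] at h1
    have h2 : ‖evalBilin (R v) (R w)‖ ≤ 1 := by
      refine (norm_evalBilin_le _ _).trans ?_
      rw [LinearIsometry.norm_map, LinearIsometry.norm_map]
      exact mul_le_one₀ hv (norm_nonneg _) hw
    calc _ ≤ ‖evalBilin (R v) (R w)‖ * _ := h1
      _ ≤ 1 * (C * ‖((m, a) : ℝ × ℝ) - (M, 0)‖ ^ 2) :=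
        mul_le_mul h2 key (norm_nonneg _) zero_le_one
      _ = _ := one_mul _
  have hnorm : ‖((m, a) : ℝ × ℝ) - (M, 0)‖ ≤ |m - M| + |a| := by
    rw [Prod.norm_def]
    refine max_le ?_ ?_
    · show ‖m - M‖ ≤ _
      rw [Real.norm_eq_abs]; linarith [abs_nonneg a]
    · show ‖a - 0‖ ≤ _
      rw [sub_zero, Real.norm_eq_abs]; linarith [abs_nonneg (m - M)]
  have hfinal : |(Φ (((m, a) : ℝ × ℝ), R y) - Φ (((M, 0) : ℝ × ℝ), R y) -
      fderiv ℝ (fun q : ℝ × ℝ ↦ Φ (q, R y)) (M, 0) ((m, a) - (M, 0))) (R v) (R w)| ≤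
      C * (|m - M| + |a|) ^ 2 :=
    hev.trans (mul_le_mul_of_nonneg_left (pow_le_pow_left₀ (norm_nonneg _) hnorm 2) hC0)
  simp only [sub_apply] at hfinal
  rw [happly, hsplit, hval, hval₀] at hfinal
  simp only [Prod.fst_sub, Prod.snd_sub, sub_zero, smul_eq_mul, LinearIsometry.inner_map_map,
    LinearIsometry.norm_map] at hfinal
  convert hfinal using 2
  ring

/-! ### The second fundamental form of the Kerr cylinders -/

/-- The `m`-derivative of the Schwarzschild cylinder second fundamental form
`k̄_m = m r₀⁻² (2m/r₀ − 1)^{1/2} dt² − r₀ (2m/r₀ − 1)^{1/2} dΩ²` at `m = M` (`2M > r₀`):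
`∂_m k̄ = ((2M/r₀−1)^{1/2}/r₀² + M/(r₀³(2M/r₀−1)^{1/2})) dt² − (2M/r₀−1)^{-1/2} ‖y‖⁻² (r₀² dΩ² read
through `y`)`. [cite: LiMei2020, (4.1)] -/
theorem hasDerivAt_kbarRep_mass {M r₀ : ℝ} (hr₀ : 0 < r₀) (h2M : r₀ < 2 * M) (y v w : E3) :
    HasDerivAt (fun m : ℝ ↦ kbarRep m r₀ y v w)
      ((Real.sqrt (2 * M / r₀ - 1) / r₀ ^ 2 + M / (r₀ ^ 3 * Real.sqrt (2 * M / r₀ - 1))) *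
          (⟪y, v⟫ * ⟪y, w⟫ / ‖y‖ ^ 2) -
        1 / (Real.sqrt (2 * M / r₀ - 1) * ‖y‖ ^ 2) * (⟪v, w⟫ - ⟪y, v⟫ * ⟪y, w⟫ / ‖y‖ ^ 2)) M := by
  have hμ : 0 < 2 * M / r₀ - 1 := by
    rw [sub_pos, lt_div_iff₀ hr₀]; linarith
  have hs0 : Real.sqrt (2 * M / r₀ - 1) ≠ 0 := (Real.sqrt_pos.2 hμ).ne'
  have hu : HasDerivAt (fun m : ℝ ↦ 2 * m / r₀ - 1) (2 / r₀) M := by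
    have h := (((hasDerivAt_id' M).const_mul 2).div_const r₀).sub_const 1
    exact h.congr_deriv (by ring)
  have hs := hu.sqrt hμ.ne'
  have h1 := (((hasDerivAt_id' M).div_const (r₀ ^ 2)).mul hs).mul_const (⟪y, v⟫ * ⟪y, w⟫ / ‖y‖ ^ 2)
  have h2 := hs.const_mul (r₀ / ‖y‖ ^ 2 * (⟪v, w⟫ - ⟪y, v⟫ * ⟪y, w⟫ / ‖y‖ ^ 2))
  have h := h1.sub h2
  have hfun : (fun m : ℝ ↦ kbarRep m r₀ y v w) = fun m ↦
      m / r₀ ^ 2 * Real.sqrt (2 * m / r₀ - 1) * (⟪y, v⟫ * ⟪y, w⟫ / ‖y‖ ^ 2) -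
        r₀ / ‖y‖ ^ 2 * (⟪v, w⟫ - ⟪y, v⟫ * ⟪y, w⟫ / ‖y‖ ^ 2) * Real.sqrt (2 * m / r₀ - 1) := by
    funext m; rw [kbarRep]; ring
  rw [hfun]
  refine h.congr_deriv ?_
  field_simp

/-- The parameter box: for `δ` small, `|m − M| + |a| ≤ δ` forces `Δ_{m,a}(r₀) < 0`. [folklore] -/
theorem exists_closedBall_subset_delta_neg {M r₀ : ℝ} (hr₀ : 0 < r₀) (h2M : r₀ < 2 * M) :
    ∃ δ : ℝ, 0 < δ ∧ δ ≤ 1 ∧ ∀ q ∈ closedBall ((M, 0) : ℝ × ℝ) δ,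
      r₀ ^ 2 - 2 * q.1 * r₀ + q.2 ^ 2 < 0 := by
  have hO : IsOpen {q : ℝ × ℝ | r₀ ^ 2 - 2 * q.1 * r₀ + q.2 ^ 2 < 0} := isOpen_delta_neg r₀
  have hM : ((M, 0) : ℝ × ℝ) ∈ {q : ℝ × ℝ | r₀ ^ 2 - 2 * q.1 * r₀ + q.2 ^ 2 < 0} := by
    show r₀ ^ 2 - 2 * M * r₀ + (0 : ℝ) ^ 2 < 0
    nlinarith
  obtain ⟨ε, hε, hball⟩ := Metric.isOpen_iff.1 hO _ hM
  refine ⟨min (ε / 2) 1, lt_min (half_pos hε) one_pos, min_le_right _ _, fun q hq ↦ hball ?_⟩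
  rw [mem_closedBall] at hq
  rw [mem_ball]
  linarith [min_le_left (ε / 2) 1]

/-- **Second-order expansion of the second fundamental form of the Kerr cylinders in `(m, a)` at
`(M, 0)`, uniformly on a shell** (Li–Mei (4.2), second line, with its `O(a²)`): for
`0 < r₀ < 2M`, `1 ≤ ρ₁`, there are `δ > 0`, `C ≥ 0` such that for `|m − M| + |a| ≤ δ`, every
rotation `R`, unit vectors `v, w` and `ρ₁ < ‖y‖ < ρ₂`,
`|K[m,a,R](y)(v,w) − k̄_M(y)(v,w) − (m − M) ∂_m k̄_M(y)(v,w)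
  − a·M(2M/r₀−1)^{1/2}/(r₀²‖y‖³)·((Ry)₁(Rv)₀ − (Ry)₀(Rv)₁)⟪y,w⟫ + ⟪y,v⟫((Ry)₁(Rw)₀ − (Ry)₀(Rw)₁))|
 ≤ C (|m − M| + |a|)²`. [cite: LiMei2020, (4.2)] -/
theorem exists_abs_cylK_taylor₂_le [Kerr.Facts] {M r₀ : ℝ} (hr₀ : 0 < r₀) (h2M : r₀ < 2 * M)
    {ρ₁ : ℝ} (hρ₁ : 1 ≤ ρ₁) (ρ₂ τ₀ : ℝ) :
    ∃ δ C : ℝ, 0 < δ ∧ 0 ≤ C ∧ ∀ (m a : ℝ), |m - M| + |a| ≤ δ → ∀ (R : E3 →ₗᵢ[ℝ] E3) (v w : E3),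
      ‖v‖ ≤ 1 → ‖w‖ ≤ 1 → ∀ y : E3, ρ₁ < ‖y‖ → ‖y‖ < ρ₂ →
        |cylK m a hr₀ τ₀ R y v w - kbarRep M r₀ y v w -
            (m - M) * ((Real.sqrt (2 * M / r₀ - 1) / r₀ ^ 2 + M / (r₀ ^ 3 * Real.sqrt (2 * M / r₀ - 1))) *
                (⟪y, v⟫ * ⟪y, w⟫ / ‖y‖ ^ 2) -
              1 / (Real.sqrt (2 * M / r₀ - 1) * ‖y‖ ^ 2) * (⟪v, w⟫ - ⟪y, v⟫ * ⟪y, w⟫ / ‖y‖ ^ 2)) -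
            a * (M * Real.sqrt (2 * M / r₀ - 1) / (r₀ ^ 2 * ‖y‖ ^ 3) *
              ((R y 1 * R v 0 - R y 0 * R v 1) * ⟪y, w⟫ + ⟪y, v⟫ * (R y 1 * R w 0 - R y 0 * R w 1)))| ≤
          C * (|m - M| + |a|) ^ 2 := by
  obtain ⟨δ, hδ, hδ1, hbox⟩ := exists_closedBall_subset_delta_neg hr₀ h2M
  -- the smooth family and the compact sets
  set Φ : (ℝ × ℝ) × E3 → (E3 →L[ℝ] E3 →L[ℝ] ℝ) := fun q ↦
    cylK₀ q.1.1 q.1.2 hr₀ τ₀ LinearIsometry.id q.2 with hΦ_def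
  set U : Set ((ℝ × ℝ) × E3) := {q | q.2 ≠ 0 ∧ r₀ ^ 2 - 2 * q.1.1 * r₀ + q.1.2 ^ 2 < 0} with hU_def
  have hU : IsOpen U :=
    (isOpen_ne.preimage continuous_snd).inter ((isOpen_delta_neg r₀).preimage continuous_fst)
  have hΦs : ContDiffOn ℝ 2 Φ U := by
    intro q hq
    have hO3 : IsOpen {q : ℝ × ℝ × E3 | q.2.2 ≠ 0 ∧ r₀ ^ 2 - 2 * q.1 * r₀ + q.2.1 ^ 2 < 0} :=
      (isOpen_ne.preimage (continuous_snd.comp continuous_snd)).inter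
        ((isOpen_delta_neg r₀).preimage (continuous_fst.prodMk (continuous_fst.comp continuous_snd)))
    have h := (contDiffOn_cylK₀₃ hr₀ τ₀ LinearIsometry.id).contDiffAt
      (hO3.mem_nhds (show (q.1.1, q.1.2, q.2) ∈ {q : ℝ × ℝ × E3 | q.2.2 ≠ 0 ∧
        r₀ ^ 2 - 2 * q.1 * r₀ + q.2.1 ^ 2 < 0} from hq))
    have h2 : ContDiffAt ℝ ∞ Φ q := h.comp q ((contDiffAt_fst.comp q contDiffAt_fst).prodMk
      ((contDiffAt_snd.comp q contDiffAt_fst).prodMk contDiffAt_snd))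
    exact (h2.of_le (WithTop.coe_le_coe.mpr le_top)).contDiffWithinAt
  have hK : IsCompact (closedBall ((M, 0) : ℝ × ℝ) δ) := isCompact_closedBall _ _
  have hKc : Convex ℝ (closedBall ((M, 0) : ℝ × ℝ) δ) := convex_closedBall _ _
  have hL : IsCompact {y : E3 | ρ₁ ≤ ‖y‖ ∧ ‖y‖ ≤ ρ₂} :=
    Metric.isCompact_of_isClosed_isBounded
      ((isClosed_le continuous_const continuous_norm).inter (isClosed_le continuous_norm continuous_const))
      (isBounded_closedBall.subset fun y hy ↦ mem_closedBall_zero_iff.2 hy.2)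
  have hL0 : ∀ y ∈ {y : E3 | ρ₁ ≤ ‖y‖ ∧ ‖y‖ ≤ ρ₂}, y ≠ 0 := fun y hy h ↦ by
    have h1 : ρ₁ ≤ ‖y‖ := hy.1
    rw [h, norm_zero] at h1
    linarith
  have hKL : closedBall ((M, 0) : ℝ × ℝ) δ ×ˢ {y : E3 | ρ₁ ≤ ‖y‖ ∧ ‖y‖ ≤ ρ₂} ⊆ U :=
    fun q hq ↦ ⟨hL0 q.2 hq.2, hbox q.1 hq.1⟩
  obtain ⟨C, hC0, hC⟩ := exists_norm_taylor₂_le_parametric hU hΦs hK hKc hL hKL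
  refine ⟨δ, C, hδ, hC0, fun m a hma R v w hv hw y hy₁ hy₂ ↦ ?_⟩
  have hy0 : y ≠ 0 := fun h ↦ by rw [h, norm_zero] at hy₁; linarith
  have hp₀ : ((M, 0) : ℝ × ℝ) ∈ closedBall ((M, 0) : ℝ × ℝ) δ := mem_closedBall_self hδ.le
  have hp : ((m, a) : ℝ × ℝ) ∈ closedBall ((M, 0) : ℝ × ℝ) δ := by
    rw [mem_closedBall, dist_eq_norm, Prod.norm_def]
    refine max_le ?_ ?_
    · show ‖m - M‖ ≤ δ
      rw [Real.norm_eq_abs]; linarith [abs_nonneg a]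
    · show ‖a - 0‖ ≤ δ
      rw [sub_zero, Real.norm_eq_abs]; linarith [abs_nonneg (m - M)]
  have hΔ : r₀ ^ 2 - 2 * m * r₀ + a ^ 2 < 0 := hbox _ hp
  have hRy : R y ∈ {y : E3 | ρ₁ ≤ ‖y‖ ∧ ‖y‖ ≤ ρ₂} := by
    refine ⟨?_, ?_⟩ <;> rw [LinearIsometry.norm_map] <;> linarith
  have hRy0 : R y ≠ 0 := isometry_apply_ne_zero R hy0
  have hRy1 : 1 < ‖R y‖ := by rw [LinearIsometry.norm_map]; linarith
  have key := hC _ hp₀ _ hp _ hRy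
  -- differentiability at the base point
  have hdiff : DifferentiableAt ℝ (fun q : ℝ × ℝ ↦ Φ (q, R y)) (M, 0) := by
    have hq : (((M, 0) : ℝ × ℝ), R y) ∈ U := ⟨hRy0, hbox _ hp₀⟩
    have hd : DifferentiableAt ℝ Φ (((M, 0) : ℝ × ℝ), R y) :=
      (hΦs.differentiableOn (by norm_num)).differentiableAt (hU.mem_nhds hq)
    have hf : DifferentiableAt ℝ (fun q : ℝ × ℝ ↦ ((q, R y) : (ℝ × ℝ) × E3)) (M, 0) :=
      differentiableAt_id.prodMk (differentiableAt_const _)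
    have h := hd.comp (M, 0) hf
    exact h
  have hdiffvw : DifferentiableAt ℝ (fun q : ℝ × ℝ ↦ Φ (q, R y) (R v) (R w)) (M, 0) :=
    (evalBilin (R v) (R w)).differentiableAt.comp _ hdiff
  -- the `m`-derivative: `Φ((s, 0), Ry) = k̄_s` for `s` near `M`
  have h₁ : HasDerivAt (fun s : ℝ ↦ Φ ((s, ((M, 0) : ℝ × ℝ).2), R y) (R v) (R w))
      ((Real.sqrt (2 * M / r₀ - 1) / r₀ ^ 2 + M / (r₀ ^ 3 * Real.sqrt (2 * M / r₀ - 1))) *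
          (⟪R y, R v⟫ * ⟪R y, R w⟫ / ‖R y‖ ^ 2) -
        1 / (Real.sqrt (2 * M / r₀ - 1) * ‖R y‖ ^ 2) *
          (⟪R v, R w⟫ - ⟪R y, R v⟫ * ⟪R y, R w⟫ / ‖R y‖ ^ 2)) ((M, 0) : ℝ × ℝ).1 := by
    have h := hasDerivAt_kbarRep_mass hr₀ h2M (R y) (R v) (R w)
    have hev : ∀ᶠ s : ℝ in 𝓝 M, r₀ < 2 * s :=
      (isOpen_lt continuous_const (continuous_const.mul continuous_id)).mem_nhds h2M
    refine h.congr_of_eventuallyEq ?_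
    filter_upwards [hev] with s hs
    show Φ ((s, 0), R y) (R v) (R w) = kbarRep s r₀ (R y) (R v) (R w)
    exact cylK₀_zero_spin hr₀ hs τ₀ LinearIsometry.id hRy1 (R v) (R w)
  -- the `a`-derivative: Li–Mei (4.2), second line
  have h₂ : HasDerivAt (fun s : ℝ ↦ Φ ((((M, 0) : ℝ × ℝ).1, s), R y) (R v) (R w))
      (M * Real.sqrt (2 * M / r₀ - 1) / (r₀ ^ 2 * ‖R y‖ ^ 3) *
        ((R y 1 * R v 0 - R y 0 * R v 1) * ⟪R y, R w⟫ +
          ⟪R y, R v⟫ * (R y 1 * R w 0 - R y 0 * R w 1))) ((M, 0) : ℝ × ℝ).2 :=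
    hasDerivAt_cylK₀_spin hr₀ h2M τ₀ hRy0 (R v) (R w)
  have hsplit := fderiv_curry_apply_of_hasDerivAt
    (Φ := fun q : (ℝ × ℝ) × E3 ↦ (Φ q (R v) (R w))) hdiffvw h₁ h₂ ((m, a) - (M, 0))
  have happly : fderiv ℝ (fun q : ℝ × ℝ ↦ Φ (q, R y)) (M, 0) ((m, a) - (M, 0)) (R v) (R w) =
      fderiv ℝ (fun q : ℝ × ℝ ↦ Φ (q, R y) (R v) (R w)) (M, 0) ((m, a) - (M, 0)) := by
    have h := ((evalBilin (R v) (R w)).hasFDerivAt.comp _ hdiff.hasFDerivAt).fderiv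
    rw [show (fun q : ℝ × ℝ ↦ Φ (q, R y) (R v) (R w)) = (evalBilin (R v) (R w)) ∘
      (fun q : ℝ × ℝ ↦ Φ (q, R y)) from rfl, h]
    rfl
  -- the values at the two parameter points
  have hval : Φ (((m, a) : ℝ × ℝ), R y) (R v) (R w) = cylK m a hr₀ τ₀ R y v w := by
    show cylK₀ m a hr₀ τ₀ LinearIsometry.id (R y) (R v) (R w) = cylK m a hr₀ τ₀ R y v w
    rw [cylK_apply, cylCutoff_of_le_norm (hρ₁.trans hy₁.le), one_mul, cylK₀_isometry hr₀ hΔ τ₀ R hy0]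
  have hval₀ : Φ (((M, 0) : ℝ × ℝ), R y) (R v) (R w) = kbarRep M r₀ y v w := by
    show cylK₀ M 0 hr₀ τ₀ LinearIsometry.id (R y) (R v) (R w) = kbarRep M r₀ y v w
    rw [cylK₀_zero_spin hr₀ h2M τ₀ LinearIsometry.id hRy1, kbarRep_isometry]
  -- assemble
  have hev : |(Φ (((m, a) : ℝ × ℝ), R y) - Φ (((M, 0) : ℝ × ℝ), R y) -
      fderiv ℝ (fun q : ℝ × ℝ ↦ Φ (q, R y)) (M, 0) ((m, a) - (M, 0))) (R v) (R w)| ≤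
      C * ‖((m, a) : ℝ × ℝ) - (M, 0)‖ ^ 2 := by
    have h1 := (evalBilin (R v) (R w)).le_opNorm (Φ (((m, a) : ℝ × ℝ), R y) -
      Φ (((M, 0) : ℝ × ℝ), R y) - fderiv ℝ (fun q : ℝ × ℝ ↦ Φ (q, R y)) (M, 0) ((m, a) - (M, 0)))
    rw [evalBilin_apply, Real.norm_eq_abs] at h1
    have h2 : ‖evalBilin (R v) (R w)‖ ≤ 1 := by
      refine (norm_evalBilin_le _ _).trans ?_
      rw [LinearIsometry.norm_map, LinearIsometry.norm_map]
      exact mul_le_one₀ hv (norm_nonneg _) hw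
    calc _ ≤ ‖evalBilin (R v) (R w)‖ * _ := h1
      _ ≤ 1 * (C * ‖((m, a) : ℝ × ℝ) - (M, 0)‖ ^ 2) :=
        mul_le_mul h2 key (norm_nonneg _) zero_le_one
      _ = _ := one_mul _
  have hnorm : ‖((m, a) : ℝ × ℝ) - (M, 0)‖ ≤ |m - M| + |a| := by
    rw [Prod.norm_def]
    refine max_le ?_ ?_
    · show ‖m - M‖ ≤ _
      rw [Real.norm_eq_abs]; linarith [abs_nonneg a]
    · show ‖a - 0‖ ≤ _
      rw [sub_zero, Real.norm_eq_abs]; linarith [abs_nonneg (m - M)]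
  have hfinal : |(Φ (((m, a) : ℝ × ℝ), R y) - Φ (((M, 0) : ℝ × ℝ), R y) -
      fderiv ℝ (fun q : ℝ × ℝ ↦ Φ (q, R y)) (M, 0) ((m, a) - (M, 0))) (R v) (R w)| ≤
      C * (|m - M| + |a|) ^ 2 :=
    hev.trans (mul_le_mul_of_nonneg_left (pow_le_pow_left₀ (norm_nonneg _) hnorm 2) hC0)
  simp only [sub_apply] at hfinal
  rw [happly, hsplit, hval, hval₀] at hfinal
  simp only [Prod.fst_sub, Prod.snd_sub, sub_zero, smul_eq_mul, LinearIsometry.inner_map_map,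
    LinearIsometry.norm_map] at hfinal
  convert hfinal using 2
  ring

end LiMei

end Literature.Geometry.Lorentzian

end
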